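/-
HONEST FRAMING: certified error envelopes and provably optimal rounding/accumulation schemes for
low-precision formats under stated cost models; every table by two implementations; no hardware
or vendor claims.
-/
import Summits.Ventures.CertifiedArithmetic.LowPrec.OptDemotionRoutingSingle

/-!
# The demotion law (Theorem T8), part 8c: the TWO-BIT ENVELOPE is `treeQf` (opt gen 13, R17(c2)(c3))

For the weighted routing value of part 8a and any weight `W` (`W (e - q) = u · W e`, `W ≥ 0`):
the value of a configuration of TWO bits `e₀ > e > e₀ - q` is given EXACTLY by opt's coupled
demotion polynomial `treeQf` (part 4) read at the weight ratio `x = W e / W e₀`: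

  `u · treeBRw q W t {e₀, e} = W e₀ · (treeQf u t x - 1 - x)`      (`treeBRw_pair`)

for EVERY summation tree `t` and every `x > 0` — the four options of the `treeQf` recursion are the
four undominated ways to route `{e₀, e}` and the injected bit `e₀ - q` through a node (opt gen 13
README §2 (c2)).  With `W e = 2^e` this is R17(c3): `u · BR_t(σ(1 + 2^-i)) = σ · E_t(2^-i)`,
equality of the bit-routing value and the excess `E_t(x) = treeQf u t x - 1 - x` at every dyadic
knot.  Also `treeM u t + y ≤ treeQf u t y` (`treeM_add_le_treeQf`: `E_t ≥ μ_t`).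
Part 8d: THEOREM R17 for arbitrary configurations.
-/

namespace Summit.Ventures.CertifiedArithmetic.LowPrec.Opt

open Literature.ComputerArithmetic.JeannerodRump2018
open Literature.ComputerArithmetic.JeannerodRump2018.SumTree

/-- `M_t + y ≤ treeQf u t y` for `y > 0`, i.e. the excess `E_t(y) = treeQf u t y - 1 - y` is at least
`μ_t = M_t - 1`. -/
theorem treeM_add_le_treeQf (u : ℚ) : ∀ (t : SumTree) {y : ℚ}, 0 < y → treeM u t + y ≤ treeQf u t y
  | .leaf _, y, _ => by simp
  | .node a b, y, hy => by
      rw [treeQf_node, treeM_node]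
      have ha := treeM_add_le_treeQf u a hy
      have hb := treeM_add_le_treeQf u b hy
      rcases le_total (treeM u b) (treeM u a) with h | h
      · rw [max_eq_left h, min_eq_right h]
        exact le_trans (by linarith) (le_trans (le_max_left _ _) (le_max_left _ _))
      · rw [max_eq_right h, min_eq_left h]
        exact le_trans (by linarith) (le_trans (le_max_right _ _) (le_max_left _ _))

/-- The excess recursion: `E_(a·b)(x) = u + max {E_a(x) + u μ_b, E_b(x) + u μ_a, μ_a + x E_b(u/x),
μ_b + x E_a(u/x)}` (`x ≠ 0`). -/
theorem treeQf_excess_node (u : ℚ) (a b : SumTree) {x : ℚ} (hx : x ≠ 0) :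
    treeQf u (.node a b) x - 1 - x = u +
      max (max (treeQf u a x - 1 - x + u * (treeM u b - 1)) (treeQf u b x - 1 - x + u * (treeM u a - 1)))
        (max (treeM u a - 1 + x * (treeQf u b (u / x) - 1 - u / x))
          (treeM u b - 1 + x * (treeQf u a (u / x) - 1 - u / x))) := by
  rw [treeQf_node]
  have e3 : treeM u a + x * treeQf u b (u / x) =
      (1 + x + u) + (treeM u a - 1 + x * (treeQf u b (u / x) - 1 - u / x)) := by
    field_simp; ring
  have e4 : treeM u b + x * treeQf u a (u / x) =
      (1 + x + u) + (treeM u b - 1 + x * (treeQf u a (u / x) - 1 - u / x)) := by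
    field_simp; ring
  have e1 : treeQf u a x + u * treeM u b = (1 + x + u) + (treeQf u a x - 1 - x + u * (treeM u b - 1)) := by
    ring
  have e2 : treeQf u b x + u * treeM u a = (1 + x + u) + (treeQf u b x - 1 - x + u * (treeM u a - 1)) := by
    ring
  rw [e1, e2, e3, e4, max_add_add_left, max_add_add_left, max_add_add_left]; ring

section Pair

variable {q : ℕ} {e₀ e : ℤ}

/-- A configuration inside `{e₀ - q, e₀, e}` containing `e₀` and `e` but not `e₀ - q` is `{e₀, e}`. -/
theorem eq_pair_of_subset {A : Finset ℤ} (hA : A ⊆ insert (e₀ - q) {e₀, e}) (hι : e₀ - (q : ℤ) ∉ A)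
    (h₀ : e₀ ∈ A) (he : e ∈ A) : A = {e₀, e} := by
  ext x
  simp only [Finset.mem_insert, Finset.mem_singleton]
  constructor
  · intro hx
    have := hA hx
    simp only [Finset.mem_insert, Finset.mem_singleton] at this
    rcases this with rfl | rfl | rfl
    · exact absurd hx hι
    · exact Or.inl rfl
    · exact Or.inr rfl
  · rintro (rfl | rfl)
    · exact h₀
    · exact he

/-- … containing `e₀` but neither `e` nor `e₀ - q` is `{e₀}`. -/
theorem eq_single_of_subset {A : Finset ℤ} (hA : A ⊆ insert (e₀ - q) {e₀, e}) (hι : e₀ - (q : ℤ) ∉ A)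
    (h₀ : e₀ ∈ A) (he : e ∉ A) : A = {e₀} := by
  ext x
  simp only [Finset.mem_singleton]
  constructor
  · intro hx
    have := hA hx
    simp only [Finset.mem_insert, Finset.mem_singleton] at this
    rcases this with rfl | rfl | rfl
    · exact absurd hx hι
    · rfl
    · exact absurd hx he
  · rintro rfl; exact h₀

/-- … containing `e` but not `e₀` is `{e}` or `{e, e₀ - q}`. -/
theorem eq_low_of_subset {A : Finset ℤ} (hA : A ⊆ insert (e₀ - q) {e₀, e}) (h₀ : e₀ ∉ A) (he : e ∈ A) :
    A = {e} ∨ A = {e, e₀ - (q : ℤ)} := by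
  by_cases hι : e₀ - (q : ℤ) ∈ A
  · right
    ext x
    simp only [Finset.mem_insert, Finset.mem_singleton]
    constructor
    · intro hx
      have := hA hx
      simp only [Finset.mem_insert, Finset.mem_singleton] at this
      rcases this with rfl | rfl | rfl
      · exact Or.inr rfl
      · exact absurd hx h₀
      · exact Or.inl rfl
    · rintro (rfl | rfl)
      · exact he
      · exact hι
  · left
    ext x
    simp only [Finset.mem_singleton]
    constructor
    · intro hx
      have := hA hx
      simp only [Finset.mem_insert, Finset.mem_singleton] at this
      rcases this with rfl | rfl | rfl
      · exact absurd hx hι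
      · exact absurd hx h₀
      · rfl
    · rintro rfl; exact he

/-- … containing neither `e₀` nor `e` is `∅` or `{e₀ - q}`. -/
theorem eq_inj_of_subset {A : Finset ℤ} (hA : A ⊆ insert (e₀ - q) {e₀, e}) (h₀ : e₀ ∉ A) (he : e ∉ A) :
    A = ∅ ∨ A = {e₀ - (q : ℤ)} := by
  have : A ⊆ {e₀ - (q : ℤ)} := by
    intro x hx
    have := hA hx
    simp only [Finset.mem_insert, Finset.mem_singleton] at this ⊢
    rcases this with rfl | rfl | rfl
    · rfl
    · exact absurd hx h₀
    · exact absurd hx he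
  exact Finset.subset_singleton_iff.1 this

end Pair

/-- THE TWO-BIT ENVELOPE (R17(c2)–(c3)): for a weight `W` (`W ≥ 0`, `W (e - q) = u W e`) and two
bits `e₀ > e > e₀ - q` of positive weight, for EVERY summation tree,
`u · treeBRw q W t {e₀, e} = W e₀ · (treeQf u t x - 1 - x)` with `x = W e / W e₀`. -/
theorem treeBRw_pair {q : ℕ} {u : ℚ} (hq : 1 ≤ q) (hu0 : 0 < u) (hu1 : u ≤ 1) {W : ℤ → ℚ}
    (hW : IsWeight q u W) (t : SumTree) :
    ∀ (e₀ e : ℤ), e < e₀ → e₀ - q < e → 0 < W e₀ → 0 < W e →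
      u * treeBRw q W t {e₀, e} = W e₀ * (treeQf u t (W e / W e₀) - 1 - W e / W e₀) := by
  induction t with
  | leaf y => intro e₀ e _ _ _ _; simp
  | node a b iha0 ihb0 =>
      intro e₀ e hlt hgt hs hsx
      -- names
      set s := W e₀ with hsdef
      set x := W e / s with hxdef
      have hx : 0 < x := div_pos hsx hs
      have hxne : x ≠ 0 := hx.ne'
      have hWe : W e = s * x := by rw [hxdef]; field_simp
      have hι : W (e₀ - q) = u * s := hW.shift e₀
      have hux : W (e₀ - q) / W e = u / x := by rw [hι, hWe]; field_simp
      -- the configuration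
      have hne : ({e₀, e} : Finset ℤ).Nonempty := Finset.insert_nonempty _ _
      have htop : ({e₀, e} : Finset ℤ).max' hne = e₀ := by
        refine le_antisymm (Finset.max'_le _ hne _ fun y hy => ?_)
          (Finset.le_max' _ _ (Finset.mem_insert_self _ _))
        simp only [Finset.mem_insert, Finset.mem_singleton] at hy
        rcases hy with rfl | rfl
        · exact le_rfl
        · exact hlt.le
      -- values on the subtrees
      have hμa : u * treeA u a = treeM u a - 1 := by
        have := one_add_mul_treeA hu0.le hu1 a; linarith
      have hμb : u * treeA u b = treeM u b - 1 := by
        have := one_add_mul_treeA hu0.le hu1 b; linarith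
      have iha := iha0 e₀ e hlt hgt hs hsx
      have ihb := ihb0 e₀ e hlt hgt hs hsx
      have hιpos : 0 < W (e₀ - q) := by rw [hι]; exact mul_pos hu0 hs
      have iha' := iha0 e (e₀ - q) hgt (by linarith) hsx hιpos
      have ihb' := ihb0 e (e₀ - q) hgt (by linarith) hsx hιpos
      rw [hux] at iha' ihb'
      rw [← hsdef, ← hxdef] at iha ihb
      have h1a := treeBRw_singleton hq hu0.le hu1 hW a
      have h1b := treeBRw_singleton hq hu0.le hu1 hW b
      -- the four options and the excess of the node
      have hE := treeQf_excess_node u a b hxne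
      have hEb' : treeM u b - 1 ≤ treeQf u b (u / x) - 1 - u / x := by
        have := treeM_add_le_treeQf u b (div_pos hu0 hx); linarith
      have hEa' : treeM u a - 1 ≤ treeQf u a (u / x) - 1 - u / x := by
        have := treeM_add_le_treeQf u a (div_pos hu0 hx); linarith
      have hEa : treeM u a - 1 ≤ treeQf u a x - 1 - x := by
        have := treeM_add_le_treeQf u a hx; linarith
      have hMa : 0 ≤ treeM u a - 1 := by have := one_le_treeM hu0.le a; linarith
      have hMb : 0 ≤ treeM u b - 1 := by have := one_le_treeM hu0.le b; linarith
      have hsx0 : 0 ≤ s * x := mul_nonneg hs.le hx.le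
      -- abbreviations for the options
      have hO1 : treeQf u a x - 1 - x + u * (treeM u b - 1) ≤ treeQf u (.node a b) x - 1 - x - u := by
        rw [hE]; linarith [le_max_left (max (treeQf u a x - 1 - x + u * (treeM u b - 1))
          (treeQf u b x - 1 - x + u * (treeM u a - 1))) (max (treeM u a - 1 + x * (treeQf u b (u / x) - 1 - u / x))
          (treeM u b - 1 + x * (treeQf u a (u / x) - 1 - u / x))),
          le_max_left (treeQf u a x - 1 - x + u * (treeM u b - 1)) (treeQf u b x - 1 - x + u * (treeM u a - 1))]
      have hO2 : treeQf u b x - 1 - x + u * (treeM u a - 1) ≤ treeQf u (.node a b) x - 1 - x - u := by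
        rw [hE]; linarith [le_max_left (max (treeQf u a x - 1 - x + u * (treeM u b - 1))
          (treeQf u b x - 1 - x + u * (treeM u a - 1))) (max (treeM u a - 1 + x * (treeQf u b (u / x) - 1 - u / x))
          (treeM u b - 1 + x * (treeQf u a (u / x) - 1 - u / x))),
          le_max_right (treeQf u a x - 1 - x + u * (treeM u b - 1)) (treeQf u b x - 1 - x + u * (treeM u a - 1))]
      have hO3 : treeM u a - 1 + x * (treeQf u b (u / x) - 1 - u / x) ≤ treeQf u (.node a b) x - 1 - x - u := by
        rw [hE]; linarith [le_max_right (max (treeQf u a x - 1 - x + u * (treeM u b - 1))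
          (treeQf u b x - 1 - x + u * (treeM u a - 1))) (max (treeM u a - 1 + x * (treeQf u b (u / x) - 1 - u / x))
          (treeM u b - 1 + x * (treeQf u a (u / x) - 1 - u / x))),
          le_max_left (treeM u a - 1 + x * (treeQf u b (u / x) - 1 - u / x))
          (treeM u b - 1 + x * (treeQf u a (u / x) - 1 - u / x))]
      have hO4 : treeM u b - 1 + x * (treeQf u a (u / x) - 1 - u / x) ≤ treeQf u (.node a b) x - 1 - x - u := by
        rw [hE]; linarith [le_max_right (max (treeQf u a x - 1 - x + u * (treeM u b - 1))
          (treeQf u b x - 1 - x + u * (treeM u a - 1))) (max (treeM u a - 1 + x * (treeQf u b (u / x) - 1 - u / x))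
          (treeM u b - 1 + x * (treeQf u a (u / x) - 1 - u / x))),
          le_max_right (treeM u a - 1 + x * (treeQf u b (u / x) - 1 - u / x))
          (treeM u b - 1 + x * (treeQf u a (u / x) - 1 - u / x))]
      set O := treeQf u (.node a b) x - 1 - x - u with hOdef
      have hO0 : 0 ≤ O := le_trans (add_nonneg (hMa.trans hEa) (mul_nonneg hu0.le hMb)) hO1
      have hsO1 := mul_le_mul_of_nonneg_left hO1 hs.le
      have hsO2 := mul_le_mul_of_nonneg_left hO2 hs.le
      have hsO3 := mul_le_mul_of_nonneg_left hO3 hs.le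
      have hsO4 := mul_le_mul_of_nonneg_left hO4 hs.le
      have hxb := mul_le_mul_of_nonneg_left hEb' hsx0
      have hxa := mul_le_mul_of_nonneg_left hEa' hsx0
      have hub : 0 ≤ s * (u * (treeM u b - 1)) := mul_nonneg hs.le (mul_nonneg hu0.le hMb)
      have hua : 0 ≤ s * (u * (treeM u a - 1)) := mul_nonneg hs.le (mul_nonneg hu0.le hMa)
      have hgoal : treeQf u (.node a b) x - 1 - x = u + O := by rw [hOdef]; ring
      rw [hgoal]
      refine le_antisymm ?_ ?_
      · ---------------- every valid split scores at most `s · O / u`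
        have hc : 0 ≤ s * O / u := div_nonneg (mul_nonneg hs.le hO0) hu0.le
        have h := treeBRw_node_le (q := q) (W := W) (a := a) (b := b) hne hc ?_
        · rw [htop] at h
          have e2 : u * (s * O / u) = s * O := by field_simp
          calc u * treeBRw q W (.node a b) {e₀, e} ≤ u * (W e₀ + s * O / u) :=
                mul_le_mul_of_nonneg_left h hu0.le
            _ = s * (u + O) := by rw [← hsdef, mul_add, e2]; ring
        intro AB hAB
        rw [htop] at hAB
        obtain ⟨hA, hB, hdisj, hcov, hrA, hrB⟩ := of_mem_splits (A := AB.1) (B := AB.2) hAB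
        rw [le_div_iff₀ hu0, mul_comm _ u]
        -- where does the leading bit go?
        have h₀ : e₀ ∈ AB.1 ∪ AB.2 := hcov (Finset.mem_insert_self _ _)
        have he' : e ∈ AB.1 ∪ AB.2 := hcov (Finset.mem_insert_of_mem (Finset.mem_singleton_self _))
        rw [Finset.mem_union] at h₀ he'
        rcases h₀ with h₀ | h₀
        · -- e₀ ∈ A
          have hιA : e₀ - (q : ℤ) ∉ AB.1 := fun h => not_routable_of_mem_mem hrA h₀ h
          have h₀B : e₀ ∉ AB.2 := fun h => Finset.disjoint_left.1 hdisj h₀ h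
          by_cases heA : e ∈ AB.1
          · have heB : e ∉ AB.2 := fun h => Finset.disjoint_left.1 hdisj heA h
            rw [eq_pair_of_subset hA hιA h₀ heA]
            rcases eq_inj_of_subset hB h₀B heB with hB' | hB' <;> rw [hB']
            · rw [treeBRw_empty, add_zero, iha]; linarith
            · rw [h1b, hι, mul_add, iha]
              have e1 : u * (u * s * treeA u b) = s * (u * (u * treeA u b)) := by ring
              rw [e1, hμb]; linarith
          · have heB : e ∈ AB.2 := he'.resolve_left heA
            rw [eq_single_of_subset hA hιA h₀ heA, h1a]
            rcases eq_low_of_subset hB h₀B heB with hB' | hB' <;> rw [hB']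
            · rw [h1b, hWe]
              have e1 : u * (s * treeA u a + s * x * treeA u b) =
                  s * (u * treeA u a) + s * x * (u * treeA u b) := by ring
              rw [e1, hμa, hμb]; linarith
            · rw [mul_add, ihb', hWe]
              have e1 : u * (s * treeA u a) = s * (u * treeA u a) := by ring
              rw [e1, hμa]; linarith
        · -- e₀ ∈ B
          have hιB : e₀ - (q : ℤ) ∉ AB.2 := fun h => not_routable_of_mem_mem hrB h₀ h
          have h₀A : e₀ ∉ AB.1 := fun h => Finset.disjoint_left.1 hdisj h h₀
          by_cases heB : e ∈ AB.2
          · have heA : e ∉ AB.1 := fun h => Finset.disjoint_left.1 hdisj h heB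
            rw [eq_pair_of_subset hB hιB h₀ heB]
            rcases eq_inj_of_subset hA h₀A heA with hA' | hA' <;> rw [hA']
            · rw [treeBRw_empty, zero_add, ihb]; linarith
            · rw [h1a, hι, mul_add, ihb]
              have e1 : u * (u * s * treeA u a) = s * (u * (u * treeA u a)) := by ring
              rw [e1, hμa]; linarith
          · have heA : e ∈ AB.1 := he'.resolve_right heB
            rw [eq_single_of_subset hB hιB h₀ heB, h1b]
            rcases eq_low_of_subset hA h₀A heA with hA' | hA' <;> rw [hA']
            · rw [h1a, hWe]
              have e1 : u * (s * x * treeA u a + s * treeA u b) =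
                  s * x * (u * treeA u a) + s * (u * treeA u b) := by ring
              rw [e1, hμa, hμb]; linarith
            · rw [mul_add, iha', hWe]
              have e1 : u * (s * treeA u b) = s * (u * treeA u b) := by ring
              rw [e1, hμb]; linarith
      · ---------------- the four undominated splits are valid
        have r2 : Routable q ({e₀, e} : Finset ℤ) := by
          intro y hy z hz
          simp only [Finset.mem_insert, Finset.mem_singleton] at hy hz
          rcases hy with rfl | rfl <;> rcases hz with rfl | rfl <;> linarith
        have r2' : Routable q ({e, e₀ - (q : ℤ)} : Finset ℤ) := by
          intro y hy z hz
          simp only [Finset.mem_insert, Finset.mem_singleton] at hy hz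
          rcases hy with rfl | rfl <;> rcases hz with rfl | rfl <;> linarith
        have r1 := routable_singleton hq
        -- ({e₀, e}, {ι})
        have m1 : (({e₀, e} : Finset ℤ), ({e₀ - (q : ℤ)} : Finset ℤ)) ∈ splits q {e₀, e} e₀ := by
          refine mem_splits.2 ⟨Or.inr ⟨Finset.subset_insert _ _, ?_⟩, r2, r1 _⟩
          ext y; simp only [Finset.mem_sdiff, Finset.mem_insert, Finset.mem_singleton]; omega
        -- ({e₀}, {e, ι})
        have m2 : (({e₀} : Finset ℤ), ({e, e₀ - (q : ℤ)} : Finset ℤ)) ∈ splits q {e₀, e} e₀ := by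
          refine mem_splits.2 ⟨Or.inr ⟨?_, ?_⟩, r1 _, r2'⟩
          · intro y hy; simp only [Finset.mem_insert, Finset.mem_singleton] at hy ⊢; omega
          · ext y; simp only [Finset.mem_sdiff, Finset.mem_insert, Finset.mem_singleton]; omega
        -- ({ι}, {e₀, e})
        have m3 : (({e₀ - (q : ℤ)} : Finset ℤ), ({e₀, e} : Finset ℤ)) ∈ splits q {e₀, e} e₀ := by
          refine mem_splits.2 ⟨Or.inr ⟨?_, ?_⟩, r1 _, r2⟩
          · intro y hy; simp only [Finset.mem_insert, Finset.mem_singleton] at hy ⊢; omega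
          · ext y; simp only [Finset.mem_sdiff, Finset.mem_insert, Finset.mem_singleton]; omega
        -- ({e, ι}, {e₀})
        have m4 : (({e, e₀ - (q : ℤ)} : Finset ℤ), ({e₀} : Finset ℤ)) ∈ splits q {e₀, e} e₀ := by
          refine mem_splits.2 ⟨Or.inr ⟨?_, ?_⟩, r2', r1 _⟩
          · intro y hy; simp only [Finset.mem_insert, Finset.mem_singleton] at hy ⊢; omega
          · ext y; simp only [Finset.mem_sdiff, Finset.mem_insert, Finset.mem_singleton]; omega
        have s1 := split_le_treeBRw_node (q := q) (W := W) (a := a) (b := b) hne (by rw [htop]; exact m1)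
        have s2 := split_le_treeBRw_node (q := q) (W := W) (a := a) (b := b) hne (by rw [htop]; exact m2)
        have s3 := split_le_treeBRw_node (q := q) (W := W) (a := a) (b := b) hne (by rw [htop]; exact m3)
        have s4 := split_le_treeBRw_node (q := q) (W := W) (a := a) (b := b) hne (by rw [htop]; exact m4)
        rw [htop, ← hsdef] at s1 s2 s3 s4
        rw [h1b, hι] at s1
        rw [h1a] at s2
        rw [h1a, hι] at s3
        rw [h1b] at s4
        -- multiply by u and evaluate
        have t1 := mul_le_mul_of_nonneg_left s1 hu0.le
        have e1 : u * (s + (treeBRw q W a {e₀, e} + u * s * treeA u b)) =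
            u * s + u * treeBRw q W a {e₀, e} + s * (u * (u * treeA u b)) := by ring
        rw [e1, iha, hμb] at t1
        have t2 := mul_le_mul_of_nonneg_left s2 hu0.le
        have e2 : u * (s + (s * treeA u a + treeBRw q W b {e, e₀ - (q : ℤ)})) =
            u * s + s * (u * treeA u a) + u * treeBRw q W b {e, e₀ - (q : ℤ)} := by ring
        rw [e2, ihb', hμa, hWe] at t2
        have t3 := mul_le_mul_of_nonneg_left s3 hu0.le
        have e3 : u * (s + (u * s * treeA u a + treeBRw q W b {e₀, e})) =
            u * s + s * (u * (u * treeA u a)) + u * treeBRw q W b {e₀, e} := by ring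
        rw [e3, ihb, hμa] at t3
        have t4 := mul_le_mul_of_nonneg_left s4 hu0.le
        have e4 : u * (s + (treeBRw q W a {e, e₀ - (q : ℤ)} + s * treeA u b)) =
            u * s + u * treeBRw q W a {e, e₀ - (q : ℤ)} + s * (u * treeA u b) := by ring
        rw [e4, iha', hμb, hWe] at t4
        -- `O` is one of the four options
        have hOeq : O = max (max (treeQf u a x - 1 - x + u * (treeM u b - 1))
            (treeQf u b x - 1 - x + u * (treeM u a - 1)))
            (max (treeM u a - 1 + x * (treeQf u b (u / x) - 1 - u / x))
              (treeM u b - 1 + x * (treeQf u a (u / x) - 1 - u / x))) := by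
          rw [hOdef, hE]; ring
        have key : s * O ≤ u * treeBRw q W (.node a b) {e₀, e} - u * s := by
          rw [hOeq]
          rcases le_total (max (treeQf u a x - 1 - x + u * (treeM u b - 1))
              (treeQf u b x - 1 - x + u * (treeM u a - 1)))
              (max (treeM u a - 1 + x * (treeQf u b (u / x) - 1 - u / x))
              (treeM u b - 1 + x * (treeQf u a (u / x) - 1 - u / x))) with hm | hm
          · rw [max_eq_right hm]
            rcases le_total (treeM u a - 1 + x * (treeQf u b (u / x) - 1 - u / x))
                (treeM u b - 1 + x * (treeQf u a (u / x) - 1 - u / x)) with hm' | hm'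
            · rw [max_eq_right hm']; linarith
            · rw [max_eq_left hm']; linarith
          · rw [max_eq_left hm]
            rcases le_total (treeQf u a x - 1 - x + u * (treeM u b - 1))
                (treeQf u b x - 1 - x + u * (treeM u a - 1)) with hm' | hm'
            · rw [max_eq_right hm']; linarith
            · rw [max_eq_left hm']; linarith
        linarith

/-- R17(c3) AT A DYADIC KNOT, weight form: two bits of positive weight. -/
theorem treeBRw_pair_le {q : ℕ} {u : ℚ} (hq : 1 ≤ q) (hu0 : 0 < u) (hu1 : u ≤ 1) {W : ℤ → ℚ}
    (hW : IsWeight q u W) (t : SumTree) {e₀ e : ℤ} (hlt : e < e₀) (hgt : e₀ - q < e)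
    (hs : 0 < W e₀) (hsx : 0 < W e) :
    u * treeBRw q W t {e₀, e} ≤ W e₀ * (treeQf u t (W e / W e₀) - 1 - W e / W e₀) :=
  (treeBRw_pair hq hu0 hu1 hW t e₀ e hlt hgt hs hsx).le

end Summit.Ventures.CertifiedArithmetic.LowPrec.Opt
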